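import Summits.ResolutionOfSingularities.ResolutionOfSingularities.Theorems.FrobeniusClosingSteerChartRsopPart
import Mathlib.RingTheory.MvPolynomial.Homogeneous
import HarnessLib

/-!
# Crux `Steer` (stmt-ResolutionOfSingularities-16345), chain W4.1 — K-β0(b) gr bridge, brick (G2):
# the STRICT TRANSFORM restricted to the exceptional divisor IS the dehomogenised INITIAL FORM (run currency)

OURS (campaign `res-hironaka`, rung L ★L-G4, slot W4.1; seat res-L0-w41-stub-4 g7 on res-L0-w41-plan-1 RULINGS 262/268(a) «K-β0(b)
`arithTransport_of` via the gr bridge; first words-free brick (G2)»). Replaces the role of no printed item; NOT a statement of the manuscript under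
review [claim: Hironaka2017, status: under-review]; AI-produced, weaker than expert review. Theses-free, definition-free, words-free.

SETTING (run currency, as in res-L0-w41-stub-3's `…ChartRsopPart`): `S ⊆ K` a subring of a field, `x : Fin r → S` a sequence with `x i ≠ 0`,
`I = (x)`, `C = S[x_j/x_i : j] ⊆ K` the chart ring of the blowing up of `Spec S` along `I` (the run's `R (i+1)` is `locAtCentre C O`). For a
form `F ∈ S[T_0, …, T_{r-1}]` of degree `d` its DEHOMOGENISATION at `i` is `F(…, T_i := 1, …) ∈ S[T_j : j ≠ i]`.
* `prod_pow_eq_pow_mul_prod_div_pow` — `x^m = x_i^|m| · ∏_j (x_j/x_i)^(m_j)` in `K`.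
* `exists_eq_pow_mul_of_mem_span_pow` — **`r ∈ Iⁿ ⇒ r = x_iⁿ · r₁` with `r₁ ∈ C`** (Stacks 052Q in run currency).
* `eval_eq_pow_mul_eval₂_dehomogenise` — `F(x) = x_i^d · F^deh(x_j/x_i)` for a form `F` of degree `d`.
* **`exists_strictTransform_initialForm`** — if `f ≡ F(x) (mod I^(d+1))` for a form `F` of degree `d`, then `f = x_i^d · f₁` with `f₁ ∈ C` and
  `f₁ mod (x_i) = ψ(F̄^deh)` for EVERY presentation `ψ : (S/I)[T_j : j ≠ i] ≅ C/(x_i)` with `ψ(C s̄) = [s]`, `ψ(T_j) = [x_j/x_i]` (the tree's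
  `ChartRsop.closure_chartQuotient_X`, Stacks 0BIQ): the restriction of the strict transform `f₁` to the exceptional divisor `x_i = 0` is the
  dehomogenised initial form. Any centre length `r` (point steps `I = 𝔪`, curve steps `I = P`), no regularity needed here.
This is the first piece of the run → gr dictionary for σ_top steps (RULING 268(a1)); the per-step cone transport reads `Ψ̄` off `F̄^deh` at the
centre of `O` on the exceptional divisor.

[cite: StacksProject, Tag 052Q] [cite: StacksProject, Tag 0BIQ] [folklore]
bears_on: LADDER-RESOLUTION L ★L-G4 W4.1 (crux `Steer`, binder hK4ⁿᶜ, K-β0(b) `ArithTransportTwoN`, gr bridge (G2)).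
-/

noncomputable section

-- `Summit.<S>.<S>.…` duplicates the summit name by design (single-problem summit).
set_option linter.dupNamespace false

open MvPolynomial

namespace Summit.ResolutionOfSingularities.ResolutionOfSingularities.Theorems.SwitchingDichotomy.NearPoint

open Summit.ResolutionOfSingularities.ResolutionOfSingularities.Theorems.SwitchingDichotomy.ChartRsop

universe u

variable {K : Type u} [Field K] (S : Subring K) {r : ℕ} (x : Fin r → S) (i : Fin r)

/-! ## §1 Monomials in the chart -/

/-- `x^m = x_i^|m| · ∏_j (x_j/x_i)^(m_j)` in `K` (`x_i ≠ 0`). -/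
theorem prod_pow_eq_pow_mul_prod_div_pow (hxi : ((x i : S) : K) ≠ 0) (m : Fin r →₀ ℕ) :
    (∏ j, ((x j : S) : K) ^ (m j)) = ((x i : S) : K) ^ m.degree * ∏ j, (((x j : S) : K) / ((x i : S) : K)) ^ (m j) := by
  rw [Finsupp.degree_eq_sum, ← Finset.prod_pow_eq_pow_sum, ← Finset.prod_mul_distrib]
  refine Finset.prod_congr rfl fun j _ => ?_
  rw [← mul_pow, mul_div_cancel₀ _ hxi]

/-- Elements of `S` lie in the chart ring. -/
theorem coe_mem_closure_chart (s : S) :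
    (s : K) ∈ Subring.closure ((S : Set K) ∪ Set.range fun j => ((x j : S) : K) / ((x i : S) : K)) :=
  le_closure_chart S x i s.2

/-- **`r ∈ Iⁿ ⇒ r = x_iⁿ · r₁` with `r₁` in the chart ring** (`I = (x)`). [cite: StacksProject, Tag 052Q] -/
theorem exists_eq_pow_mul_of_mem_span_pow (hxi : ((x i : S) : K) ≠ 0) (n : ℕ) (r' : S)
    (hr : r' ∈ Ideal.span (Set.range x) ^ n) :
    ∃ r₁ ∈ Subring.closure ((S : Set K) ∪ Set.range fun j => ((x j : S) : K) / ((x i : S) : K)),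
      (r' : K) = ((x i : S) : K) ^ n * r₁ := by
  classical
  induction n generalizing r' with
  | zero => exact ⟨r', coe_mem_closure_chart S x i r', by rw [pow_zero, one_mul]⟩
  | succ n ih =>
    rw [pow_succ] at hr
    refine Submodule.mul_induction_on hr (fun a ha b hb => ?_) (fun a b ⟨a₁, ha₁, ha⟩ ⟨b₁, hb₁, hb⟩ => ?_)
    · obtain ⟨a₁, ha₁, ha⟩ := ih a ha
      obtain ⟨c, hc⟩ := Ideal.mem_span_range_iff_exists_fun.mp hb
      -- `b = Σ c_j x_j = x_i · Σ c_j (x_j/x_i)`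
      refine ⟨a₁ * ∑ j, (c j : K) * (((x j : S) : K) / ((x i : S) : K)), Subring.mul_mem _ ha₁
        (Subring.sum_mem _ fun j _ => Subring.mul_mem _ (coe_mem_closure_chart S x i (c j))
          (Subring.subset_closure (Or.inr ⟨j, rfl⟩))), ?_⟩
      rw [Subring.coe_mul, ha, ← hc, AddSubmonoidClass.coe_finsetSum, Finset.mul_sum, Finset.mul_sum, Finset.mul_sum]
      refine Finset.sum_congr rfl fun j _ => ?_
      rw [Subring.coe_mul, pow_succ]
      field_simp
    · exact ⟨a₁ + b₁, Subring.add_mem _ ha₁ hb₁, by rw [Subring.coe_add, ha, hb, mul_add]⟩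

/-! ## §2 Forms: `F(x) = x_i^d · F^deh(x_j/x_i)` -/

/-- The dehomogenising substitution at `i`: `T_i ↦ 1`, `T_j ↦ T_j` (`j ≠ i`). (Written out, no definition.) -/
theorem aeval_dehomogenise_X (j : Fin r) :
    aeval (fun j : Fin r => if h : j = i then (1 : MvPolynomial {j : Fin r // j ≠ i} S) else X ⟨j, h⟩) (X j : MvPolynomial (Fin r) S) =
      if h : j = i then 1 else X ⟨j, h⟩ :=
  aeval_X _ j

/-- The dehomogenised monomial evaluated in the chart: `∏_j (T_j^deh)(x/x_i)^(m_j) = ∏_j (x_j/x_i)^(m_j)` (the factor `j = i` is `1`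
on both sides since `x_i/x_i = 1`). -/
theorem prod_eval₂_dehomogenise_X_pow (hxi : ((x i : S) : K) ≠ 0) (m : Fin r →₀ ℕ) :
    (∏ j, (eval₂ S.subtype (fun j : {j : Fin r // j ≠ i} => ((x j.1 : S) : K) / ((x i : S) : K))
        (if h : j = i then (1 : MvPolynomial {j : Fin r // j ≠ i} S) else X ⟨j, h⟩)) ^ (m j)) =
      ∏ j, (((x j : S) : K) / ((x i : S) : K)) ^ (m j) := by
  refine Finset.prod_congr rfl fun j _ => ?_
  by_cases h : j = i
  · subst h
    rw [dif_pos rfl, eval₂_one, div_self hxi]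
  · rw [dif_neg h, eval₂_X]

/-- **`F(x) = x_i^d · F^deh(x_j/x_i)` in `K`** for a form `F` of degree `d` over `S`. -/
theorem eval_eq_pow_mul_eval₂_dehomogenise (hxi : ((x i : S) : K) ≠ 0) (d : ℕ) (F : MvPolynomial (Fin r) S)
    (hF : F.IsHomogeneous d) :
    ((MvPolynomial.eval x F : S) : K) = ((x i : S) : K) ^ d *
      eval₂ S.subtype (fun j : {j : Fin r // j ≠ i} => ((x j.1 : S) : K) / ((x i : S) : K))
        (aeval (fun j : Fin r => if h : j = i then (1 : MvPolynomial {j : Fin r // j ≠ i} S) else X ⟨j, h⟩) F) := by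
  classical
  conv_lhs => rw [F.as_sum]
  conv_rhs => rw [F.as_sum]
  rw [map_sum, map_sum, ← coe_eval₂Hom, map_sum, Finset.mul_sum]
  change S.subtype (∑ m ∈ F.support, eval x (monomial m (coeff m F))) = _
  rw [map_sum]
  refine Finset.sum_congr rfl fun m hm => ?_
  have hdeg : m.degree = d := by
    have := hF (mem_support_iff.mp hm)
    rw [Finsupp.degree_eq_weight_one]
    exact this
  -- left: `c · ∏ x_j^(m_j) = c · x_i^d · ∏ (x_j/x_i)^(m_j)`
  rw [eval_monomial, Finsupp.prod_fintype _ _ (fun j => by rw [pow_zero]), map_mul, map_prod]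
  simp only [map_pow, Subring.subtype_apply]
  rw [prod_pow_eq_pow_mul_prod_div_pow S x i hxi m, hdeg]
  -- right: `x_i^d · (c · ∏ (x_j/x_i)^(m_j))`
  rw [aeval_monomial, Finsupp.prod_fintype _ _ (fun j => by rw [pow_zero]), map_mul, map_prod, MvPolynomial.algebraMap_eq,
    eval₂Hom_C, Subring.subtype_apply]
  simp only [map_pow, coe_eval₂Hom]
  rw [prod_eval₂_dehomogenise_X_pow S x i hxi m]
  ring

/-- Every `P(x_j/x_i)`, `P ∈ S[T_j : j ≠ i]`, lies in the chart ring. -/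
theorem closure_chartQuotient_X_aux_mem (P : MvPolynomial {j : Fin r // j ≠ i} S) :
    eval₂ S.subtype (fun j : {j : Fin r // j ≠ i} => ((x j.1 : S) : K) / ((x i : S) : K)) P ∈
      Subring.closure ((S : Set K) ∪ Set.range fun j => ((x j : S) : K) / ((x i : S) : K)) := by
  classical
  induction P using MvPolynomial.induction_on with
  | C s => rw [eval₂_C]; exact coe_mem_closure_chart S x i s
  | add p q hp hq => rw [eval₂_add]; exact Subring.add_mem _ hp hq
  | mul_X p j hp =>
    rw [eval₂_mul, eval₂_X]
    exact Subring.mul_mem _ hp (Subring.subset_closure (Or.inr ⟨j.1, rfl⟩))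

/-! ## §3 The strict transform restricted to the exceptional divisor -/

/-- Any presentation `ψ : (S/I)[T_j : j ≠ i] → C/(x_i)` with `ψ (C s̄) = [s]` and `ψ (T_j) = [x_j/x_i]` sends the reduction of a polynomial
`P ∈ S[T_j : j ≠ i]` to the class of `P(x_j/x_i)`. -/
theorem presentation_map_eq_mk_eval₂
    (ψ : MvPolynomial {j : Fin r // j ≠ i} (S ⧸ Ideal.span (Set.range x)) →+*
        Subring.closure ((S : Set K) ∪ Set.range fun j => ((x j : S) : K) / ((x i : S) : K)) ⧸
          Ideal.span {(⟨(x i : K), le_closure_chart S x i (x i).2⟩ :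
            Subring.closure ((S : Set K) ∪ Set.range fun j => ((x j : S) : K) / ((x i : S) : K)))})
    (hψC : ∀ s : S, ψ (MvPolynomial.C (Ideal.Quotient.mk _ s)) = Ideal.Quotient.mk _ ⟨(s : K), le_closure_chart S x i s.2⟩)
    (hψX : ∀ j : {j : Fin r // j ≠ i}, ψ (MvPolynomial.X j) =
      Ideal.Quotient.mk _ ⟨((x j.1 : S) : K) / ((x i : S) : K), div_mem_closure_chart S x i j.1⟩)
    (P : MvPolynomial {j : Fin r // j ≠ i} S)
    (hP : eval₂ S.subtype (fun j : {j : Fin r // j ≠ i} => ((x j.1 : S) : K) / ((x i : S) : K)) P ∈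
      Subring.closure ((S : Set K) ∪ Set.range fun j => ((x j : S) : K) / ((x i : S) : K))) :
    ψ (MvPolynomial.map (Ideal.Quotient.mk (Ideal.span (Set.range x))) P) = Ideal.Quotient.mk _ ⟨_, hP⟩ := by
  classical
  -- compare the two ring maps `S[T] → C/(x_i)` on generators
  have key : ∀ Q : MvPolynomial {j : Fin r // j ≠ i} S,
      ∀ hQ : eval₂ S.subtype (fun j : {j : Fin r // j ≠ i} => ((x j.1 : S) : K) / ((x i : S) : K)) Q ∈
        Subring.closure ((S : Set K) ∪ Set.range fun j => ((x j : S) : K) / ((x i : S) : K)),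
      ψ (MvPolynomial.map (Ideal.Quotient.mk (Ideal.span (Set.range x))) Q) = Ideal.Quotient.mk _ ⟨_, hQ⟩ := by
    intro Q
    induction Q using MvPolynomial.induction_on with
    | C s =>
      intro hQ
      rw [MvPolynomial.map_C, hψC]
      congr 1
      exact Subtype.ext (by simp)
    | add p q hp hq =>
      intro hQ
      have hp' : eval₂ S.subtype (fun j : {j : Fin r // j ≠ i} => ((x j.1 : S) : K) / ((x i : S) : K)) p ∈ _ :=
        (closure_chartQuotient_X_aux_mem S x i p)
      have hq' : eval₂ S.subtype (fun j : {j : Fin r // j ≠ i} => ((x j.1 : S) : K) / ((x i : S) : K)) q ∈ _ :=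
        (closure_chartQuotient_X_aux_mem S x i q)
      rw [map_add, map_add, hp hp', hq hq', ← map_add]
      congr 1
      exact Subtype.ext (by simp [eval₂_add])
    | mul_X p j hp =>
      intro hQ
      have hp' : eval₂ S.subtype (fun j : {j : Fin r // j ≠ i} => ((x j.1 : S) : K) / ((x i : S) : K)) p ∈ _ :=
        (closure_chartQuotient_X_aux_mem S x i p)
      rw [map_mul, MvPolynomial.map_X, map_mul, hp hp', hψX, ← map_mul]
      congr 1
      exact Subtype.ext (by simp [eval₂_mul, eval₂_X])
  exact key P hP

/-- **THE STRICT TRANSFORM RESTRICTED TO THE EXCEPTIONAL DIVISOR IS THE DEHOMOGENISED INITIAL FORM** (run currency, brick (G2)).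
If `f ≡ F(x) (mod I^(d+1))` for a form `F` of degree `d` over `S` (`I = (x)`), then on the chart `x_i ≠ 0`: `f = x_i^d · f₁` with `f₁` in the
chart ring `C = S[x_j/x_i]`, and modulo `x_i` (the exceptional divisor) `f₁` is the dehomogenised reduction `F̄(…, T_i := 1, …)` read through
ANY presentation `ψ : (S/I)[T_j : j ≠ i] ≅ C/(x_i)` with `ψ (C s̄) = [s]`, `ψ (T_j) = [x_j/x_i]` (tree `ChartRsop.closure_chartQuotient_X`).
[cite: StacksProject, Tag 052Q] [cite: StacksProject, Tag 0BIQ] -/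
theorem exists_strictTransform_initialForm (hxi : x i ≠ 0) (d : ℕ) (F : MvPolynomial (Fin r) S) (hF : F.IsHomogeneous d) (f : S)
    (hf : f - MvPolynomial.eval x F ∈ Ideal.span (Set.range x) ^ (d + 1))
    (ψ : MvPolynomial {j : Fin r // j ≠ i} (S ⧸ Ideal.span (Set.range x)) →+*
        Subring.closure ((S : Set K) ∪ Set.range fun j => ((x j : S) : K) / ((x i : S) : K)) ⧸
          Ideal.span {(⟨(x i : K), le_closure_chart S x i (x i).2⟩ :
            Subring.closure ((S : Set K) ∪ Set.range fun j => ((x j : S) : K) / ((x i : S) : K)))})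
    (hψC : ∀ s : S, ψ (MvPolynomial.C (Ideal.Quotient.mk _ s)) = Ideal.Quotient.mk _ ⟨(s : K), le_closure_chart S x i s.2⟩)
    (hψX : ∀ j : {j : Fin r // j ≠ i}, ψ (MvPolynomial.X j) =
      Ideal.Quotient.mk _ ⟨((x j.1 : S) : K) / ((x i : S) : K), div_mem_closure_chart S x i j.1⟩) :
    ∃ f₁ : Subring.closure ((S : Set K) ∪ Set.range fun j => ((x j : S) : K) / ((x i : S) : K)),
      (f : K) = ((x i : S) : K) ^ d * (f₁ : K) ∧
      Ideal.Quotient.mk _ f₁ = ψ (MvPolynomial.map (Ideal.Quotient.mk (Ideal.span (Set.range x)))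
        (aeval (fun j : Fin r => if h : j = i then (1 : MvPolynomial {j : Fin r // j ≠ i} S) else X ⟨j, h⟩) F)) := by
  classical
  have hxi' : ((x i : S) : K) ≠ 0 := fun h => hxi (Subtype.ext h)
  set Fdeh := aeval (fun j : Fin r => if h : j = i then (1 : MvPolynomial {j : Fin r // j ≠ i} S) else X ⟨j, h⟩) F with hFdeh
  -- the remainder: `f − F(x) = x_i^(d+1) · r₁`
  obtain ⟨r₁, hr₁, hr⟩ := exists_eq_pow_mul_of_mem_span_pow S x i hxi' (d + 1) _ hf
  have hP := closure_chartQuotient_X_aux_mem S x i Fdeh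
  -- `f₁ := F^deh(x_j/x_i) + x_i · r₁`
  refine ⟨⟨_, hP⟩ + ⟨(x i : K), le_closure_chart S x i (x i).2⟩ * ⟨r₁, hr₁⟩, ?_, ?_⟩
  · have hfx : (f : K) = ((MvPolynomial.eval x F : S) : K) + ((x i : S) : K) ^ (d + 1) * r₁ := by
      rw [← hr, AddSubgroupClass.coe_sub, add_sub_cancel]
    rw [hfx, eval_eq_pow_mul_eval₂_dehomogenise S x i hxi' d F hF, Subring.coe_add, Subring.coe_mul, pow_succ]
    change _ = _ * (eval₂ S.subtype _ Fdeh + (x i : K) * r₁)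
    ring
  · have h0 : Ideal.Quotient.mk (Ideal.span {(⟨(x i : K), le_closure_chart S x i (x i).2⟩ :
        Subring.closure ((S : Set K) ∪ Set.range fun j => ((x j : S) : K) / ((x i : S) : K)))})
        ⟨(x i : K), le_closure_chart S x i (x i).2⟩ = 0 :=
      Ideal.Quotient.eq_zero_iff_mem.mpr (Ideal.subset_span rfl)
    rw [map_add, map_mul, h0, zero_mul, add_zero, presentation_map_eq_mk_eval₂ S x i ψ hψC hψX Fdeh hP]

end Summit.ResolutionOfSingularities.ResolutionOfSingularities.Theorems.SwitchingDichotomy.NearPoint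

end
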